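import Summits.NavierStokesRegularity.FluidComputer.PalasekTowerRegisterGlobalHeredity

/-!
# REGISTER v2.3′: the `EpisodeBaseG` side by name — host preparation (rung `0`), re-forcing
# bookkeeping, and the first-episode TRAPS (∀-schedule and re-forcing forms)

Cell `ns-blowup`, seat `ns-blowup-ecbridge-1` (g4); companion of `PalasekTowerRegisterGlobal.lean`
(p411629: the items of record `EpisodeBaseG` / `EpisodeInductionG` of the route
`PalasekTowerBreakdown`, items stmt-NavierStokesRegularity-19179 / -19178),
`PalasekTowerRegisterGlobalTail.lean` (p412736: the rung ladder `RungG K`),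
`PalasekTowerRegisterGlobalHeredity.lean` (p415576: `HeredityAt k` / `HeredityFrom k₀`) and
`PalasekTowerReforce.lean` (p406876: `Schedule.reforce`, `Schedule.silenced`, the force-insensitivity
finding). LABEL: E–C typing (KERNEL vocabulary + NEGATIVE KNOWLEDGE: named open `Prop`s, their
interlocks, and two kernel trap lemmas; every implication proved). WHAT THIS IS NOT: not Navier–Stokes
evidence — no stage, push, tower or instance is constructed or claimed; the `@[conjecture]`
definitions are never asserted, and the two `FirstEpisode*` definitions are NOT split children of the
route (planner RULING STATUS l.1890: item 19179 stays ONE item until a design predicate is typed).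

## Why (planner BC3 birth skeleton `EpisodeBaseG_birth.lean` c9e75b33c1a07c32, STATUS l.1566; planner OBJECTION l.1832; ecbridge-4 OBJECTION l.1875; planner RULING l.1890 (3): «ecbridge-1 g4 keeps BASE-R §1 `HostPreparation ↔ RungG 0` + §2 re-forcing bookkeeping + §3 as NAMED TRAPS ONLY — `FirstEpisode` with `FirstEpisode.extends_silenced`, and `FirstEpisodeR` with the `c₄ = 0` silence lemma; that negative knowledge is worth landing»)

* §1 `HostPreparation` — some pinned (`Λ = 8`, `θ = 6/5`), rigid, quiet schedule on the wide-base
  rates carries a globally anchored registered stage at LEVEL `0`. Definitionally rung `0`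
  (`hostPreparation_iff_rungG_zero`, `Iff.rfl`); a TRUNCATION of K1G (`EpisodeBaseG.hostPreparation`).
* §2 Re-forcing bookkeeping: the pins (given confinement of the new force), rigidity, quietness
  (iff the new force vanishes from `τ 1`) and the v2.3′ route margin survive `Schedule.reforce`
  (`Margins.forceBlind_routeG`); transport `Stage.reforceG`; every instant of `[τ 0, T)` lies in a
  growth window (`Schedule.exists_window`).
* §3 THE TRAPS. (a) The skeleton's stub `FirstEpisode` quantifies over EVERY pinned rigid quiet
  schedule with its OWN force (`= HeredityAt 0`): silencing the force smoothly right after `τ 0` stays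
  in the class and keeps the host, so it asserts an UNFORCED first compaction `0 → 1` at
  `Re₀ = 256^{0.3} ≈ 5.3` (`FirstEpisode.extends_silenced`, kernel; planner l.1832). (b) The
  re-forcing form `FirstEpisodeR` (∃ an admissible push `g` for `S.reforce`) keeps the trap on the
  schedules registered with `c₄ = 0` — e.g. the registered schedule of record
  (`TowerRates.exists_registered_schedule`): there every admissible push vanishes on `[τ 0, ∞)`
  (`FirstEpisodeR.push_eq_zero_of_c₄_eq_zero`, kernel; ecbridge-4 l.1875 (1)). (c) Declared for
  both and for any ∀-over-hosts variant (ecbridge-4 l.1875 (3), planner l.1890): a registered level-0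
  host is pinned only by the level-0 readouts, so such forms ask EVERY flow meeting the level-0
  numbers — adversarial minimal hosts included — to double its maximal speed inside
  `w₀ = c₅ log N₁ / A₀` by its own inertia. The compositions `episodeBaseG_of_host_first(R)` are
  proved for the record (they WOULD give K1G); the filing shape of record is over a NAMED design
  class of hosts (`GoodHost`, ecbridge-4's pen), not typed here.
* §4 The planner's unconditional alias for the 19178 split glue
  (`episodeInductionG_of_heredityAtOne_of_heredityFrom_two`, l.1789 (3)(i)).

References: S. Palasek, arXiv:2605.13827 §3.3–§4 and Rem. 1.4 [cite: Palasek2026ElementaryModel, §4];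
C. L. Fefferman, Clay problem description, (C) [cite: FeffermanClay2006, (C)].
-/

noncomputable section

namespace Summit.NavierStokesRegularity.FluidComputer.PalasekTowerClayBridge

open Set MeasureTheory Filter Topology Function Real
open scoped ENNReal ContDiff NNReal
open Literature.Analysis.FluidPDE

/-! ## §1 Host preparation = rung `0` -/

/-- **HOST PREPARATION** (open; never asserted; planner BC3 stub `host_preparation` verbatim): some
pinned (`Λ = 8`, `θ = 6/5`), rigid, quiet schedule on the wide-base rates carries a GLOBALLY ANCHORED
registered stage at LEVEL `0` at unit viscosity — its Clay datum, pushed by its Clay-class force on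
`[0, τ 0)` (where `Schedule.push_small` does not bind), reaches at `τ 0`, inside the ball, the
velocity floor `c₁ Y₀` (met first at `τ 0`: the global anchor), the strain floor `c₁ A₀` and a
level-0 core loop, under the ceiling `c₂ Y₀` on `[0, τ 0]`. [cite: Palasek2026ElementaryModel, §3.3] -/
@[conjecture] def HostPreparation : Prop :=
  ∃ S : Schedule TowerRates.wide, S.Pins 8 (6 / 5) ∧ S.Rigid ∧ S.Quiet ∧
    Nonempty (Stage 1 TowerRates.wide S (Margins.routeG TowerRates.wide) 0)

/-- Host preparation IS rung `0` of the v2.3′ ladder (definitionally). [folklore] -/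
theorem hostPreparation_iff_rungG_zero : HostPreparation ↔ RungG 0 := Iff.rfl

/-- **Host preparation is a TRUNCATION of K1G** (a proof of it is a witness of weakness OF
`EpisodeBaseG`): the level-1 stage restricts to a level-0 stage of the same schedule (the route margin
is antitone). [folklore] -/
theorem EpisodeBaseG.hostPreparation (h : EpisodeBaseG) : HostPreparation :=
  hostPreparation_iff_rungG_zero.2 ((rungG_one_iff.2 h).mono (Nat.zero_le 1))

/-- Every rung contains host preparation. [folklore] -/
theorem RungG.hostPreparation {K : ℕ} (h : RungG K) : HostPreparation :=
  hostPreparation_iff_rungG_zero.2 (h.mono (Nat.zero_le K))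

/-! ## §2 Re-forcing bookkeeping -/

namespace Schedule

variable {R : TowerRates} {S : Schedule R} {Λ θ : ℝ}
  {g : ℝ → EuclideanSpace ℝ (Fin 3) → EuclideanSpace ℝ (Fin 3)}
  {h₁ : IsSmoothOnHalfSpace g} {h₂ : HasRapidSpaceTimeDecay g}
  {h₃ : ∀ t, S.T ≤ t → ∀ x, g t x = 0}
  {h₄ : ∀ k, ∀ t ∈ Icc (S.τ k) (S.τ (k + 1)), ∀ x, ‖g t x‖ ≤ S.c₄ * R.Y k}

/-- The pins survive re-forcing by a CONFINED force (impulse and separation read constants and times,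
the datum is kept). [folklore] -/
theorem Pins.reforce (h : S.Pins Λ θ) (hg : ∀ t x, S.radius < ‖x‖ → g t x = 0) :
    (S.reforce g h₁ h₂ h₃ h₄).Pins Λ θ :=
  ⟨h.impulse, h.sep, h.datum_confined, hg⟩

/-- Rigidity survives re-forcing (it reads times and constants only). [folklore] -/
theorem Rigid.reforce (h : S.Rigid) : (S.reforce g h₁ h₂ h₃ h₄).Rigid :=
  ⟨h.window_eq, h.c₅_eq, h.c₁_eq, h.c₂_eq⟩

/-- The re-forced schedule is quiet iff the new force vanishes from `τ 1` on. [folklore] -/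
theorem reforce_quiet_iff : (S.reforce g h₁ h₂ h₃ h₄).Quiet ↔ ∀ t, S.τ 1 ≤ t → g t = 0 := Iff.rfl

/-- **Every instant of `[τ 0, T)` lies in a growth window** `[τ k, τ (k+1)]` (the readout times
increase from `τ 0` and exhaust `[0, T)`, `Schedule.exists_lt_τ`). [folklore] -/
theorem exists_window (S : Schedule R) {t : ℝ} (h0 : S.τ 0 ≤ t) (hT : t < S.T) :
    ∃ k, t ∈ Icc (S.τ k) (S.τ (k + 1)) := by
  classical
  have hex : ∃ n, t < S.τ (n + 1) := S.exists_lt_τ hT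
  refine ⟨Nat.find hex, ?_, (Nat.find_spec hex).le⟩
  rcases (Nat.find hex).eq_zero_or_pos with h | h
  · rw [h]; exact h0
  · obtain ⟨m, hm⟩ := Nat.exists_eq_add_of_lt h
    have hm' : Nat.find hex = m + 1 := by omega
    have hmin := Nat.find_min hex (show m < Nat.find hex by omega)
    rw [hm']
    exact le_of_not_gt hmin

/-- On a schedule registered with `c₄ = 0`, an admissible window force VANISHES identically from the
first readout on (windows cover `[τ 0, T)`, silence covers `[T, ∞)`). [folklore] -/
theorem eq_zero_of_push_small_of_c₄_eq_zero (S : Schedule R) (hc : S.c₄ = 0)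
    {g : ℝ → EuclideanSpace ℝ (Fin 3) → EuclideanSpace ℝ (Fin 3)}
    (h₃ : ∀ t, S.T ≤ t → ∀ x, g t x = 0)
    (h₄ : ∀ k, ∀ t ∈ Icc (S.τ k) (S.τ (k + 1)), ∀ x, ‖g t x‖ ≤ S.c₄ * R.Y k)
    {t : ℝ} (ht : S.τ 0 ≤ t) (x : EuclideanSpace ℝ (Fin 3)) : g t x = 0 := by
  rcases le_or_gt S.T t with hT | hT
  · exact h₃ t hT x
  · obtain ⟨k, hk⟩ := S.exists_window ht hT
    have h := h₄ k t hk x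
    rw [hc, zero_mul] at h
    exact norm_le_zero_iff.1 h

end Schedule

/-- **The v2.3′ route margin is force-blind**: strain floors, the global anchor, rigidity and the core
ledger read the schedule only through its times, constants and ball. [folklore] -/
theorem Margins.forceBlind_routeG (R : TowerRates) : (Margins.routeG R).ForceBlind :=
  fun _ _ _ _ _ _ _ _ h => ⟨h.1, h.2.1, ⟨h.2.2.1.window_eq, h.2.2.1.c₅_eq, h.2.2.1.c₁_eq,
    h.2.2.1.c₂_eq⟩, h.2.2.2⟩

/-- **Transport of a registered stage to a re-forced schedule** whose force agrees with the old one on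
the stage's slab (`Stage.reforce` with the route margin carried by `Margins.forceBlind_routeG`).
[folklore] -/
def Stage.reforceG {ν : ℝ} {R : TowerRates} {S : Schedule R} {k : ℕ}
    (s : Stage ν R S (Margins.routeG R) k) (g : ℝ → EuclideanSpace ℝ (Fin 3) → EuclideanSpace ℝ (Fin 3))
    (h₁ : IsSmoothOnHalfSpace g) (h₂ : HasRapidSpaceTimeDecay g)
    (h₃ : ∀ t, S.T ≤ t → ∀ x, g t x = 0)
    (h₄ : ∀ k, ∀ t ∈ Icc (S.τ k) (S.τ (k + 1)), ∀ x, ‖g t x‖ ≤ S.c₄ * R.Y k)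
    (hg : ∀ t ∈ Icc 0 (S.τ k), ∀ x, g t x = S.f t x) :
    Stage ν R (S.reforce g h₁ h₂ h₃ h₄) (Margins.routeG R) k :=
  s.reforce g h₁ h₂ h₃ h₄ hg (Margins.forceBlind_routeG R S g h₁ h₂ h₃ h₄ k s.u s.margin)

/-- The transported stage has the same velocity. [folklore] -/
@[simp] theorem Stage.reforceG_u {ν : ℝ} {R : TowerRates} {S : Schedule R} {k : ℕ}
    (s : Stage ν R S (Margins.routeG R) k) (g : ℝ → EuclideanSpace ℝ (Fin 3) → EuclideanSpace ℝ (Fin 3))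
    (h₁ : IsSmoothOnHalfSpace g) (h₂ : HasRapidSpaceTimeDecay g)
    (h₃ : ∀ t, S.T ≤ t → ∀ x, g t x = 0)
    (h₄ : ∀ k, ∀ t ∈ Icc (S.τ k) (S.τ (k + 1)), ∀ x, ‖g t x‖ ≤ S.c₄ * R.Y k)
    (hg : ∀ t ∈ Icc 0 (S.τ k), ∀ x, g t x = S.f t x) :
    (s.reforceG g h₁ h₂ h₃ h₄ hg).u = s.u := rfl

/-- The transported stage has the same pressure. [folklore] -/
@[simp] theorem Stage.reforceG_p {ν : ℝ} {R : TowerRates} {S : Schedule R} {k : ℕ}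
    (s : Stage ν R S (Margins.routeG R) k) (g : ℝ → EuclideanSpace ℝ (Fin 3) → EuclideanSpace ℝ (Fin 3))
    (h₁ : IsSmoothOnHalfSpace g) (h₂ : HasRapidSpaceTimeDecay g)
    (h₃ : ∀ t, S.T ≤ t → ∀ x, g t x = 0)
    (h₄ : ∀ k, ∀ t ∈ Icc (S.τ k) (S.τ (k + 1)), ∀ x, ‖g t x‖ ≤ S.c₄ * R.Y k)
    (hg : ∀ t ∈ Icc 0 (S.τ k), ∀ x, g t x = S.f t x) :
    (s.reforceG g h₁ h₂ h₃ h₄ hg).p = s.p := rfl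

/-! ## §3 The first-episode TRAPS (not split children — planner RULING l.1890) -/

/-- **TRAP (a): THE FIRST EPISODE, ∀-SCHEDULE FORM** (open; never asserted; the BC3 stub `first_episode`
verbatim — kept as a NAMED TRAP, NOT a split child of item 19179, planner RULING STATUS l.1890): every
globally anchored registered level-0 stage of a pinned (`Λ = 8`, `θ = 6/5`), rigid, quiet schedule on
the wide-base rates extends to a level-1 stage UNDER THE SCHEDULE'S OWN FORCE. Because the class
«pinned, rigid, quiet» is closed under silencing the force right after `τ 0` and a level-0 stage reads
the force on `[0, τ 0]` only, this form asserts an UNFORCED first compaction `0 → 1`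
(`FirstEpisode.extends_silenced`) — nobody's bet (in Palasek's model the push IS the first episode,
Rem. 1.4). [cite: Palasek2026ElementaryModel, §4] -/
@[conjecture] def FirstEpisode : Prop :=
  ∀ S : Schedule TowerRates.wide, S.Pins 8 (6 / 5) → S.Rigid → S.Quiet →
    ∀ s : Stage 1 TowerRates.wide S (Margins.routeG TowerRates.wide) 0,
      ∃ s' : Stage 1 TowerRates.wide S (Margins.routeG TowerRates.wide) 1, s.Extends s'

/-- The ∀-schedule first episode IS heredity at level `0` (definitionally). [folklore] -/
theorem firstEpisode_iff_heredityAt_zero : FirstEpisode ↔ HeredityAt 0 := Iff.rfl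

/-- Heredity from level `0` is the ∀-schedule first episode together with K2G (peeling at `0`).
[folklore] -/
theorem heredityFrom_zero_iff : HeredityFrom 0 ↔ FirstEpisode ∧ EpisodeInductionG :=
  (heredityFrom_iff 0).trans (and_congr firstEpisode_iff_heredityAt_zero.symm
    episodeInductionG_iff_heredityFrom_one.symm)

/-- **TRAP (a) in the kernel**: the ∀-schedule first episode makes every registered level-0 host reach
LEVEL 1 with the push SWITCHED OFF smoothly right after `τ 0` — for any pinned rigid `S` (quiet or
not) and any `b ∈ (τ 0, τ 1]`, the schedule re-forced by `S.silenced (τ 0) b` (`= S.f` up to `τ 0`,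
`= 0` from `b` on; admissible: `silenced_smooth/decay/silent/push_small/confined`) is again pinned,
rigid and quiet, carries the host (`Stage.reforceG`), and `FirstEpisode` extends it there: an unforced
first compaction `0 → 1` at `Re₀ = N₀^{β-2} = 256^{0.3}`. [cite: Palasek2026ElementaryModel, Rem. 1.4] -/
theorem FirstEpisode.extends_silenced (h : FirstEpisode) {S : Schedule TowerRates.wide}
    (hP : S.Pins 8 (6 / 5)) (hR : S.Rigid)
    (s₀ : Stage 1 TowerRates.wide S (Margins.routeG TowerRates.wide) 0) {b : ℝ} (hb : S.τ 0 < b)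
    (hb₁ : b ≤ S.τ 1) :
    ∃ s₁ : Stage 1 TowerRates.wide
        (S.reforce (S.silenced (S.τ 0) b) Schedule.silenced_smooth
          (Schedule.silenced_decay hP.force_confined) Schedule.silenced_silent
          Schedule.silenced_push_small)
        (Margins.routeG TowerRates.wide) 1,
      (∀ t ∈ Icc 0 (S.τ 0), s₁.u t = s₀.u t ∧ s₁.p t = s₀.p t) ∧
      ∀ t, b ≤ t → ∀ x,
        (S.reforce (S.silenced (S.τ 0) b) Schedule.silenced_smooth
          (Schedule.silenced_decay hP.force_confined) Schedule.silenced_silent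
          Schedule.silenced_push_small).f t x = 0 := by
  have hg : ∀ t ∈ Icc 0 (S.τ 0), ∀ x, S.silenced (S.τ 0) b t x = S.f t x :=
    fun t ht x => Schedule.silenced_eq_of_le hb ht.2 x
  set S' := S.reforce (S.silenced (S.τ 0) b) Schedule.silenced_smooth
    (Schedule.silenced_decay hP.force_confined) Schedule.silenced_silent Schedule.silenced_push_small
    with hS'
  have hP' : S'.Pins 8 (6 / 5) := hP.reforce (Schedule.silenced_confined hP.force_confined)
  have hR' : S'.Rigid := hR.reforce
  have hQ' : S'.Quiet := fun t ht => by
    funext x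
    exact Schedule.silenced_eq_zero_of_le hb (hb₁.trans ht) x
  obtain ⟨s₁, hs₁⟩ := h S' hP' hR' hQ' (s₀.reforceG _ _ _ _ _ hg)
  exact ⟨s₁, fun t ht => hs₁ t ht, fun t ht x => Schedule.silenced_eq_zero_of_le hb ht x⟩

/-- **TRAP (b): THE FIRST EPISODE, RE-FORCING FORM** (open; never asserted; planner OBJECTION l.1832's
re-type — WITHDRAWN as a filing shape by RULING l.1890 and kept as a NAMED TRAP, NOT a split child of
item 19179): for every pinned, rigid, quiet schedule `S` on the wide-base rates and every registered
level-0 host `s₀` there is an admissible push `g` for `S.reforce` (Clay class, silent from `T`,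
`‖g‖ ≤ c₄ Y_k` on the growth windows WITH THE SCHEDULE'S OWN `c₄`, equal to `S.f` on
`[0, τ 0] × ℝ³`, the re-forced schedule again pinned, rigid, quiet) under which the host continues to
a registered level-1 stage. The trap (ecbridge-4 l.1875): on schedules registered with `c₄ = 0` every
admissible push vanishes on `[τ 0, ∞)` (`FirstEpisodeR.push_eq_zero_of_c₄_eq_zero`), so this again
asserts an unforced first compaction there; and every ∀-over-hosts form, re-forced or re-pushed,
asks adversarial minimal hosts to double their maximal speed inside `w₀`.
[cite: Palasek2026ElementaryModel, §3.3] -/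
@[conjecture] def FirstEpisodeR : Prop :=
  ∀ S : Schedule TowerRates.wide, S.Pins 8 (6 / 5) → S.Rigid → S.Quiet →
    ∀ s₀ : Stage 1 TowerRates.wide S (Margins.routeG TowerRates.wide) 0,
      ∃ (g : ℝ → EuclideanSpace ℝ (Fin 3) → EuclideanSpace ℝ (Fin 3))
        (h₁ : IsSmoothOnHalfSpace g) (h₂ : HasRapidSpaceTimeDecay g)
        (h₃ : ∀ t, S.T ≤ t → ∀ x, g t x = 0)
        (h₄ : ∀ k, ∀ t ∈ Icc (S.τ k) (S.τ (k + 1)), ∀ x, ‖g t x‖ ≤ S.c₄ * TowerRates.wide.Y k),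
        (∀ t ∈ Icc 0 (S.τ 0), ∀ x, g t x = S.f t x) ∧
        (S.reforce g h₁ h₂ h₃ h₄).Pins 8 (6 / 5) ∧ (S.reforce g h₁ h₂ h₃ h₄).Rigid ∧
        (S.reforce g h₁ h₂ h₃ h₄).Quiet ∧
        ∃ s₁ : Stage 1 TowerRates.wide (S.reforce g h₁ h₂ h₃ h₄) (Margins.routeG TowerRates.wide) 1,
          ∀ t ∈ Icc 0 (S.τ 0), s₁.u t = s₀.u t ∧ s₁.p t = s₀.p t

/-- Trap (a) implies trap (b) (push := the schedule's own force; re-forcing a schedule by its own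
force is the same schedule, by structure eta). [folklore] -/
theorem FirstEpisode.firstEpisodeR (h : FirstEpisode) : FirstEpisodeR := by
  intro S hP hR hQ s₀
  obtain ⟨s₁, hs₁⟩ := h S hP hR hQ s₀
  exact ⟨S.f, S.force_smooth, S.force_decay, S.force_silent, S.push_small, fun t _ x => rfl,
    hP, hR, hQ, s₁, hs₁⟩

/-- **TRAP (b) in the kernel**: on a pinned rigid quiet schedule registered with `c₄ = 0` (such as the
registered schedule of record), the push that `FirstEpisodeR` provides for a registered host VANISHES
identically from `τ 0` on (`Schedule.eq_zero_of_push_small_of_c₄_eq_zero`) — and still a level-1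
stage continuing the host exists under it: an unforced first compaction `0 → 1`, as in trap (a).
[cite: Palasek2026ElementaryModel, Rem. 1.4] -/
theorem FirstEpisodeR.push_eq_zero_of_c₄_eq_zero (h : FirstEpisodeR) {S : Schedule TowerRates.wide}
    (hP : S.Pins 8 (6 / 5)) (hR : S.Rigid) (hQ : S.Quiet) (hc : S.c₄ = 0)
    (s₀ : Stage 1 TowerRates.wide S (Margins.routeG TowerRates.wide) 0) :
    ∃ (g : ℝ → EuclideanSpace ℝ (Fin 3) → EuclideanSpace ℝ (Fin 3))
      (h₁ : IsSmoothOnHalfSpace g) (h₂ : HasRapidSpaceTimeDecay g)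
      (h₃ : ∀ t, S.T ≤ t → ∀ x, g t x = 0)
      (h₄ : ∀ k, ∀ t ∈ Icc (S.τ k) (S.τ (k + 1)), ∀ x, ‖g t x‖ ≤ S.c₄ * TowerRates.wide.Y k),
      (∀ t, S.τ 0 ≤ t → ∀ x, g t x = 0) ∧
      ∃ s₁ : Stage 1 TowerRates.wide (S.reforce g h₁ h₂ h₃ h₄) (Margins.routeG TowerRates.wide) 1,
        ∀ t ∈ Icc 0 (S.τ 0), s₁.u t = s₀.u t ∧ s₁.p t = s₀.p t := by
  obtain ⟨g, h₁, h₂, h₃, h₄, -, -, -, -, s₁, hs₁⟩ := h S hP hR hQ s₀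
  exact ⟨g, h₁, h₂, h₃, h₄, fun t ht x => S.eq_zero_of_push_small_of_c₄_eq_zero hc h₃ h₄ ht x,
    s₁, hs₁⟩

/-- For the record: the ORIGINAL skeleton's composition (`EpisodeBaseG_of`; planner ask l.1789 (3)(ii),
explicit binders in the order `HostPreparation → FirstEpisode → EpisodeBaseG`) — trap (a) WOULD give
K1G from host preparation. [folklore] -/
theorem episodeBaseG_of_host_first (h₁ : HostPreparation) (h₂ : FirstEpisode) : EpisodeBaseG :=
  rungG_one_iff.1 ((hostPreparation_iff_rungG_zero.1 h₁).succ_of_heredityAt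
    (firstEpisode_iff_heredityAt_zero.1 h₂))

/-- For the record: the re-forcing form's composition — trap (b) WOULD give K1G from host preparation
(re-force the host's schedule by the provided push; explicit binders in the order
`HostPreparation → FirstEpisodeR → EpisodeBaseG`). [folklore] -/
theorem episodeBaseG_of_host_firstR (h₁ : HostPreparation) (h₂ : FirstEpisodeR) : EpisodeBaseG := by
  obtain ⟨S, hP, hR, hQ, ⟨s₀⟩⟩ := h₁
  obtain ⟨g, hg₁, hg₂, hg₃, hg₄, -, hP', hR', hQ', s₁, -⟩ := h₂ S hP hR hQ s₀
  exact ⟨S.reforce g hg₁ hg₂ hg₃ hg₄, hP', hR', hQ', ⟨s₁⟩⟩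

/-! ## §4 The planner's unconditional alias for the 19178 split glue -/

/-- **The glue of the 19178 split with explicit binders** (planner ask STATUS l.1789 (3)(i), in the
order `HeredityAtOne → HeredityFrom 2 → EpisodeInductionG`): the first rung and heredity from level
`2` give K2G. [folklore] -/
theorem episodeInductionG_of_heredityAtOne_of_heredityFrom_two (h₁ : HeredityAtOne)
    (h₂ : HeredityFrom 2) : EpisodeInductionG :=
  episodeInductionG_iff_heredityAtOne_and_heredityFrom_two.2 ⟨h₁, h₂⟩

end Summit.NavierStokesRegularity.FluidComputer.PalasekTowerClayBridge

end
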